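import Mathlib.RingTheory.Ideal.KrullsHeightTheorem
import Mathlib.RingTheory.KrullDimension.Polynomial
import Mathlib.RingTheory.KrullDimension.Field
import Mathlib.RingTheory.Jacobson.Ring
import Mathlib.Algebra.MvPolynomial.Equiv
import Mathlib.RingTheory.Unramified.Finite
import Mathlib.RingTheory.Etale.Basic
import Mathlib.RingTheory.Smooth.Flat
import Mathlib.RingTheory.Ideal.GoingDown
import Mathlib.RingTheory.Artinian.Ring
import Mathlib.RingTheory.Spectrum.Prime.Noetherian
import Mathlib.RingTheory.RingHom.StandardSmooth
import Mathlib.AlgebraicGeometry.Morphisms.Smooth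
import Mathlib.AlgebraicGeometry.Properties
import Mathlib.Topology.KrullDimension
import Literature.AlgebraicGeometry.Motives.Varieties
import HarnessLib

/-!
# Dimension of smooth schemes over a field; discharge of `Literature.AlgebraicGeometry.Motives.schemeDim_eq`

`Literature.AlgebraicGeometry.Motives.Varieties` records as a named fact
`Literature.schemeDim_eq : IsSmoothProjective n X → schemeDim X.left = n`: a smooth projective
geometrically irreducible variety of relative dimension `n` over a field `k` has (topological
Krull) dimension `n`. This file proves it (`Literature.AlgebraicGeometry.Motives.schemeDim_eq_holds`), in the sharper form

* `Literature.AlgebraicGeometry.Motives.topologicalKrullDim_eq_of_smoothOfRelativeDimension`: a *non-empty* scheme `X` with a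
  morphism `X → Spec K` to the spectrum of a field that is smooth of relative dimension `n`
  (Mathlib `SmoothOfRelativeDimension`, i.e. locally standard smooth of relative dimension `n`,
  Görtz–Wedhorn I Def. 6.14) has `topologicalKrullDim X = n`

(projectivity is not used; geometric irreducibility only supplies non-emptiness). The argument is
the one of Görtz–Wedhorn I, Lemma 5.7 (4) with Lemma 6.26, run through Mathlib's commutative
algebra:

1. `dim X = sup_x dim 𝒪_{X,x}` for every scheme (`Scheme.topologicalKrullDim_eq_iSup_ringKrullDim_stalk`,
   Görtz–Wedhorn I Lemma 5.7 (4); Mathlib `ringKrullDim_stalk_eq_coheight` and the order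
   isomorphism between irreducible closed subsets and points of a sober space).
2. Every point has an affine open neighbourhood `V` with `K → Γ(X, V)` standard smooth of relative
   dimension `n` (`exists_isStandardSmoothOfRelativeDimension_of_field`), and `𝒪_{X,x}` is the
   localisation of `Γ(X, V)` at the corresponding prime, so `dim 𝒪_{X,x}` is a height in
   `Γ(X, V)`.
3. **Ring-theoretic core** (`height_eq_of_isStandardSmoothOfRelativeDimension`): if `S` is a
   standard smooth `K`-algebra of relative dimension `n`, every maximal ideal of `S` has height
   `n` (Görtz–Wedhorn I Lemma 6.26: `dim 𝒪_{X,x} = d` at closed points of a scheme smooth of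
   relative dimension `d`; hence every prime has height `≤ n`). Proof: `K → S` factors as
   `K → K[X₁,…,Xₙ] → S` with the second map étale (Mathlib
   `Algebra.IsStandardSmoothOfRelativeDimension.exists_etale_mvPolynomial`); a maximal ideal `M`
   of `S` contracts to a maximal ideal `p` of the Jacobson ring `K[X₁,…,Xₙ]`
   (`Ideal.isMaximal_under_of_finiteType`, Zariski's lemma), which has height `n`
   (`MvPolynomial.height_eq_of_isMaximal`, by induction from Mathlib
   `Polynomial.height_eq_height_add_one`); and `ht M = ht p + dim (S/pS)_M = ht p` by the
   dimension formula for flat (going-down) extensions (Mathlib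
   `Ideal.height_eq_height_add_of_liesOver_of_hasGoingDown`, Stacks 00ON) since the fibre
   `S/pS` of the unramified map is finite over the field `K[X]/p`, hence Artinian
   (`Ideal.height_eq_zero_of_formallyUnramified`).

## References

* U. Görtz, T. Wedhorn, *Algebraic Geometry I: Schemes*, 2nd ed., Springer Spektrum (2020),
  doi:10.1007/978-3-658-30733-2: Lemma 5.7 (dimension of a scheme is the supremum of the
  dimensions of its local rings), Corollary 5.18 and Theorem 5.22 (dimension of affine space and
  of local rings at closed points), Def. 6.14 (smooth of relative dimension `d`), Lemma 6.26
  (`dim 𝒪_{X,x} ≤ d`, with equality at closed points, for `X` smooth of relative dimension `d`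
  at `x`). [GortzWedhorn2020]
* The Stacks project, Tag 00ON (dimension formula `ht P = ht p + ht (P/pS)` under going down),
  Tag 00OW (Noether normalisation / Zariski's lemma), Tag 054L (dimension of schemes locally of
  finite type over a field). [StacksProject]
* R. Hartshorne, *Algebraic Geometry*, GTM 52, Springer (1977): II Ex. 3.20, III.10 (relative
  dimension of smooth morphisms). [Hartshorne1977]
-/

universe u

open Polynomial Ideal

namespace Literature.AlgebraicGeometry.Motives

/-! ### Heights of maximal ideals: polynomial rings, Jacobson rings, unramified and étale maps -/

/-- Every maximal ideal of `k[X₁, …, Xₙ]` (`k` a field) has height `n`; equivalently the local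
rings of `𝔸ⁿ_k` at closed points have dimension `n` (Görtz–Wedhorn I, Cor. 5.18 with
Thm. 5.22 (2)). Proof by induction on `n`: a maximal ideal `P` of `R[X]`, `R = k[X₁,…,Xₙ]`
Jacobson, contracts to a maximal ideal `p` of `R` (Mathlib
`Polynomial.isMaximal_comap_C_of_isJacobsonRing`) and `ht P = ht p + 1` (Mathlib
`Polynomial.height_eq_height_add_one`).
[cite: GortzWedhorn2020, Cor. 5.18 and Thm. 5.22 (2)] -/
theorem MvPolynomial.height_eq_of_isMaximal (k : Type*) [Field k] :
    ∀ (n : ℕ) (M : Ideal (MvPolynomial (Fin n) k)) [M.IsMaximal], M.height = n := by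
  intro n
  induction n with
  | zero =>
    intro M hM
    have h0 : ringKrullDim (MvPolynomial (Fin 0) k) = 0 := by
      rw [MvPolynomial.ringKrullDim_of_isNoetherianRing, ringKrullDim_eq_zero_of_field]
      simp
    have h1 : (M.height : WithBot ℕ∞) ≤ 0 :=
      h0 ▸ Ideal.height_le_ringKrullDim_of_ne_top hM.ne_top
    have h2 : M.height ≤ 0 := by exact_mod_cast h1
    simpa using h2
  | succ n ih =>
    intro M hM
    let e := (MvPolynomial.finSuccEquiv k n).toRingEquiv
    set P : Ideal (Polynomial (MvPolynomial (Fin n) k)) := M.map e with hP_def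
    have hP : P.IsMaximal := Ideal.map_isMaximal_of_equiv e
    let p : Ideal (MvPolynomial (Fin n) k) := P.comap C
    have hp : p.IsMaximal := Polynomial.isMaximal_comap_C_of_isJacobsonRing P
    have : P.LiesOver p := ⟨by rw [Ideal.under_def, Polynomial.algebraMap_eq]⟩
    rw [← e.height_map M, Polynomial.height_eq_height_add_one p P, ih p]
    push_cast
    rfl

variable {R S : Type*} [CommRing R] [CommRing S] [Algebra R S]

/-- Over a Jacobson ring `R`, maximal ideals of a finite type `R`-algebra `S` contract to maximal
ideals of `R`: `S/M` is a field of finite type over `R`, hence finite over `R` by Zariski's lemma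
(Mathlib `finite_of_finite_type_of_isJacobsonRing`, Stacks 0CY7/00OW), so `R/(M ∩ R) ⊆ S/M` is
a field. Geometrically: morphisms locally of finite type between Jacobson schemes send closed
points to closed points. [cite: StacksProject, Tag 00OW (Zariski's lemma, cf. Tag 0CY7)] -/
theorem Ideal.isMaximal_under_of_finiteType [IsJacobsonRing R] [Algebra.FiniteType R S]
    (M : Ideal S) [hM : M.IsMaximal] : (M.under R).IsMaximal := by
  letI := Ideal.Quotient.field M
  haveI : Module.Finite R (S ⧸ M) := finite_of_finite_type_of_isJacobsonRing R (S ⧸ M)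
  haveI : Algebra.IsIntegral R (S ⧸ M) := Algebra.IsIntegral.of_finite R _
  have h := Ideal.isMaximal_comap_of_isIntegral_of_isMaximal (R := R) (⊥ : Ideal (S ⧸ M))
  have e : (⊥ : Ideal (S ⧸ M)).comap (algebraMap R (S ⧸ M)) = M.under R := by
    rw [IsScalarTower.algebraMap_eq R S (S ⧸ M), ← Ideal.comap_comap, ← RingHom.ker_eq_comap_bot,
      Ideal.Quotient.algebraMap_eq, Ideal.mk_ker, Ideal.under_def]
  rwa [e] at h

/-- The fibre of a formally unramified, essentially of finite type algebra `S` over a maximal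
ideal `p` of `R` is zero-dimensional: every prime of `S ⧸ pS` has height `0`. Indeed `S/pS` is
formally unramified and essentially of finite type over the field `R/p`, hence a finite
`R/p`-module (Mathlib `Algebra.FormallyUnramified.finite_of_free`, Stacks 00UW), hence Artinian.
[cite: StacksProject, Tag 00UW] -/
theorem Ideal.height_eq_zero_of_formallyUnramified
    [Algebra.FormallyUnramified R S] [Algebra.EssFiniteType R S]
    (p : Ideal R) [p.IsMaximal] (Q : Ideal (S ⧸ p.map (algebraMap R S))) [hQ : Q.IsPrime] :
    Q.height = 0 := by
  letI := Ideal.Quotient.field p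
  haveI : Module.Finite (R ⧸ p) (S ⧸ p.map (algebraMap R S)) :=
    Algebra.FormallyUnramified.finite_of_free _ _
  haveI : IsArtinianRing (S ⧸ p.map (algebraMap R S)) := isArtinian_of_tower (R ⧸ p) inferInstance
  have h0 : ringKrullDim (S ⧸ p.map (algebraMap R S)) ≤ 0 := Ring.krullDimLE_iff.mp inferInstance
  have h1 : (Q.height : WithBot ℕ∞) ≤ 0 :=
    (Ideal.height_le_ringKrullDim_of_ne_top hQ.ne_top).trans h0
  have h2 : Q.height ≤ 0 := by exact_mod_cast h1
  simpa using h2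

/-- **Étale maps preserve heights of closed points.** For an étale algebra `S` over a noetherian
ring `R` and a maximal ideal `M` of `S` lying over a maximal ideal `p = M ∩ R`, `ht M = ht p`:
by the dimension formula for extensions satisfying going down (flat ones do),
`ht M = ht p + ht (M/pS)` (Mathlib `Ideal.height_eq_height_add_of_liesOver_of_hasGoingDown`,
Stacks 00ON), and the second term vanishes because the fibre of an unramified map over `p` is
Artinian (`Ideal.height_eq_zero_of_formallyUnramified`). [cite: StacksProject, Tag 00ON] -/
theorem Ideal.height_eq_height_under_of_etale [IsNoetherianRing R] [Algebra.Etale R S]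
    (M : Ideal S) [M.IsMaximal] [(M.under R).IsMaximal] : M.height = (M.under R).height := by
  haveI : IsNoetherianRing S := Algebra.FiniteType.isNoetherianRing R S
  haveI : (M.map (Ideal.Quotient.mk ((M.under R).map (algebraMap R S)))).IsPrime :=
    Ideal.map_isPrime_of_surjective Ideal.Quotient.mk_surjective
      (by rw [Ideal.mk_ker]; exact Ideal.map_le_iff_le_comap.mpr le_rfl)
  rw [Ideal.height_eq_height_add_of_liesOver_of_hasGoingDown (M.under R) M,
    Ideal.height_eq_zero_of_formallyUnramified (M.under R) _, add_zero]

/-! ### Standard smooth algebras of relative dimension `n` over a field have dimension `n` -/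

/-- **Closed points of a smooth `K`-scheme of relative dimension `n` have `n`-dimensional local
rings** (Görtz–Wedhorn I, Lemma 6.26, affine form): if `S` is a standard smooth algebra of
relative dimension `n` over a field `K`, every maximal ideal `M` of `S` has height `n`. Proof:
`K → S` factors as `K → K[X₁,…,Xₙ] → S` with `K[X₁,…,Xₙ] → S` étale (Mathlib
`Algebra.IsStandardSmoothOfRelativeDimension.exists_etale_mvPolynomial`); `M` contracts to a
maximal ideal of `K[X₁,…,Xₙ]` (`Ideal.isMaximal_under_of_finiteType`), of height `n`
(`MvPolynomial.height_eq_of_isMaximal`), and étale maps preserve heights of closed points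
(`Ideal.height_eq_height_under_of_etale`). [cite: GortzWedhorn2020, Lemma 6.26] -/
theorem height_eq_of_isStandardSmoothOfRelativeDimension (K : Type*) [Field K] [Algebra K S]
    (n : ℕ) [Algebra.IsStandardSmoothOfRelativeDimension n K S] (M : Ideal S) [M.IsMaximal] :
    M.height = n := by
  obtain ⟨g, hg⟩ := Algebra.IsStandardSmoothOfRelativeDimension.exists_etale_mvPolynomial n K S
  algebraize [g.toRingHom]
  haveI := Ideal.isMaximal_under_of_finiteType (R := MvPolynomial (Fin n) K) M
  rw [Ideal.height_eq_height_under_of_etale (R := MvPolynomial (Fin n) K) M,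
    MvPolynomial.height_eq_of_isMaximal K n (M.under _)]

/-- Every prime ideal of a standard smooth algebra of relative dimension `n` over a field has
height at most `n` (Görtz–Wedhorn I, Lemma 6.26: `dim 𝒪_{X,x} ≤ d`); immediate from
`height_eq_of_isStandardSmoothOfRelativeDimension` and monotonicity of height.
[cite: GortzWedhorn2020, Lemma 6.26] -/
theorem height_le_of_isStandardSmoothOfRelativeDimension (K : Type*) [Field K] [Algebra K S]
    (n : ℕ) [Algebra.IsStandardSmoothOfRelativeDimension n K S] (Q : Ideal S) [hQ : Q.IsPrime] :
    Q.height ≤ n := by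
  obtain ⟨M, hM, hQM⟩ := Q.exists_le_maximal hQ.ne_top
  rw [← height_eq_of_isStandardSmoothOfRelativeDimension K n M]
  exact Ideal.height_mono hQM

/-- A non-trivial standard smooth algebra of relative dimension `n` over a field has Krull
dimension `n` (Görtz–Wedhorn I, Lemma 6.26 with Lemma 5.7 (4); for `n`-space itself
Cor. 5.18). [cite: GortzWedhorn2020, Lemma 6.26 and Cor. 5.18] -/
theorem ringKrullDim_eq_of_isStandardSmoothOfRelativeDimension (K : Type*) [Field K] [Algebra K S]
    (n : ℕ) [Algebra.IsStandardSmoothOfRelativeDimension n K S] [Nontrivial S] :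
    ringKrullDim S = n := by
  apply le_antisymm
  · exact (ringKrullDim_le_iff_isMaximal_height_le _).mpr fun M hM => by
      rw [height_eq_of_isStandardSmoothOfRelativeDimension K n M]
      exact_mod_cast le_rfl
  · obtain ⟨M, hM⟩ := Ideal.exists_maximal S
    have := Ideal.height_le_ringKrullDim_of_ne_top hM.ne_top
    rwa [height_eq_of_isStandardSmoothOfRelativeDimension K n M] at this

/-- `RingHom` form of `ringKrullDim_eq_of_isStandardSmoothOfRelativeDimension`: if
`f : K →+* S` is standard smooth of relative dimension `n`, `K` a field and `S ≠ 0`, then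
`dim S = n`. [cite: GortzWedhorn2020, Lemma 6.26 and Cor. 5.18] -/
theorem RingHom.ringKrullDim_eq_of_isStandardSmoothOfRelativeDimension {K : Type*} [Field K]
    {n : ℕ} {f : K →+* S} (hf : f.IsStandardSmoothOfRelativeDimension n) [Nontrivial S] :
    ringKrullDim S = n := by
  algebraize [f]
  exact Literature.AlgebraicGeometry.Motives.ringKrullDim_eq_of_isStandardSmoothOfRelativeDimension K n

/-! ### Schemes smooth of relative dimension `n` over a field -/

section Scheme

open _root_.AlgebraicGeometry CategoryTheory TopologicalSpace

variable {K : Type u} [Field K] {X : Scheme.{u}} (f : X ⟶ Spec (CommRingCat.of K)) (n : ℕ)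

/-- **Local charts over a field.** If `f : X → Spec K` is smooth of relative dimension `n`
(Görtz–Wedhorn I, Def. 6.14; Mathlib `SmoothOfRelativeDimension`), every point of `X` has an
affine open neighbourhood `V` together with a ring map `K → Γ(X, V)` that is standard smooth of
relative dimension `n` (the chart `Γ(Spec K, U) → Γ(X, V)` of the definition, where necessarily
`U = Spec K`, composed with `K ≅ Γ(Spec K, ⊤)`). [cite: GortzWedhorn2020, Def. 6.14] -/
theorem exists_isStandardSmoothOfRelativeDimension_of_field [SmoothOfRelativeDimension n f]
    (x : X) : ∃ (V : X.Opens) (_ : IsAffineOpen V) (_ : x ∈ V) (φ : K →+* Γ(X, V)),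
      φ.IsStandardSmoothOfRelativeDimension n := by
  obtain ⟨U, hU, V, hV, hxV, e, hstd⟩ :=
    SmoothOfRelativeDimension.exists_isStandardSmoothOfRelativeDimension (n := n) (f := f) x
  have hUtop : U = ⊤ := by
    ext y
    simp only [Opens.coe_top, Set.mem_univ, iff_true]
    have : f x ∈ U := e hxV
    rwa [Subsingleton.elim y (f x)]
  subst hUtop
  refine ⟨V, hV, hxV, (f.appLE ⊤ V e).hom.comp
    (Scheme.ΓSpecIso (CommRingCat.of K)).commRingCatIsoToRingEquiv.symm.toRingHom, ?_⟩
  exact RingHom.isStandardSmoothOfRelativeDimension_respectsIso.2 _ _ hstd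

/-- The local rings of a scheme smooth of relative dimension `n` over a field have dimension at
most `n` (Görtz–Wedhorn I, Lemma 6.26): `𝒪_{X,x}` is the localisation of a chart `Γ(X, V)` at a
prime, whose height is at most `n` (`height_le_of_isStandardSmoothOfRelativeDimension`).
[cite: GortzWedhorn2020, Lemma 6.26] -/
theorem ringKrullDim_stalk_le_of_smoothOfRelativeDimension [SmoothOfRelativeDimension n f]
    (x : X) : ringKrullDim (X.presheaf.stalk x) ≤ n := by
  obtain ⟨V, hV, hxV, φ, hφ⟩ := exists_isStandardSmoothOfRelativeDimension_of_field f n x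
  algebraize [φ]
  have := hV.isLocalization_stalk ⟨x, hxV⟩
  rw [@IsLocalization.AtPrime.ringKrullDim_eq_height _ _ (hV.primeIdealOf ⟨x, hxV⟩).asIdeal _
    (X.presheaf.stalk x) _ (TopCat.Presheaf.algebra_section_stalk X.presheaf ⟨x, hxV⟩) this]
  exact_mod_cast height_le_of_isStandardSmoothOfRelativeDimension K n _

/-- In a non-empty scheme smooth of relative dimension `n` over a field some local ring has
dimension exactly `n`: the point of an affine chart `V` corresponding to a maximal ideal of
`Γ(X, V)` (Görtz–Wedhorn I, Lemma 6.26: equality `dim 𝒪_{X,x} = d` at closed points).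
[cite: GortzWedhorn2020, Lemma 6.26] -/
theorem exists_ringKrullDim_stalk_eq_of_smoothOfRelativeDimension [SmoothOfRelativeDimension n f]
    (x : X) : ∃ y : X, ringKrullDim (X.presheaf.stalk y) = n := by
  obtain ⟨V, hV, hxV, φ, hφ⟩ := exists_isStandardSmoothOfRelativeDimension_of_field f n x
  algebraize [φ]
  obtain ⟨M, hM, -⟩ := (hV.primeIdealOf ⟨x, hxV⟩).asIdeal.exists_le_maximal
    (hV.primeIdealOf ⟨x, hxV⟩).isPrime.ne_top
  let y : PrimeSpectrum Γ(X, V) := ⟨M, hM.isPrime⟩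
  have hy : hV.fromSpec y ∈ V := by
    rw [← SetLike.mem_coe, ← hV.range_fromSpec]
    exact Set.mem_range_self y
  refine ⟨hV.fromSpec y, ?_⟩
  have := hV.isLocalization_stalk' y hy
  rw [@IsLocalization.AtPrime.ringKrullDim_eq_height _ _ M _ (X.presheaf.stalk (hV.fromSpec y)) _
    (TopCat.Presheaf.algebra_section_stalk X.presheaf ⟨hV.fromSpec y, hy⟩) this]
  exact_mod_cast height_eq_of_isStandardSmoothOfRelativeDimension K n M

/-- **The dimension of a scheme is the supremum of the dimensions of its local rings**
(Görtz–Wedhorn I, Lemma 5.7 (4)): irreducible closed subsets of the sober space `X` correspond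
to points (Mathlib `irreducibleSetEquivPoints`), the Krull dimension of the specialisation order
is the supremum of the coheights of points, and `coheight x = dim 𝒪_{X,x}` (Mathlib
`AlgebraicGeometry.ringKrullDim_stalk_eq_coheight`, Stacks 02IZ).
[cite: GortzWedhorn2020, Lemma 5.7 (4)] -/
theorem Scheme.topologicalKrullDim_eq_iSup_ringKrullDim_stalk (X : Scheme.{u}) :
    topologicalKrullDim X = ⨆ x : X, ringKrullDim (X.presheaf.stalk x) := by
  rw [topologicalKrullDim, Order.krullDim_eq_of_orderIso (irreducibleSetEquivPoints (α := X)),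
    Order.krullDim_eq_iSup_coheight]
  simp_rw [AlgebraicGeometry.ringKrullDim_stalk_eq_coheight]

/-- **A non-empty scheme smooth of relative dimension `n` over a field has dimension `n`**
(Görtz–Wedhorn I, Lemma 6.26 with Lemma 5.7 (4); Hartshorne III.10). Combine
`Scheme.topologicalKrullDim_eq_iSup_ringKrullDim_stalk` with the two stalk computations above.
[cite: GortzWedhorn2020, Lemma 6.26 and Lemma 5.7 (4)] -/
theorem topologicalKrullDim_eq_of_smoothOfRelativeDimension [SmoothOfRelativeDimension n f]
    [Nonempty X] : topologicalKrullDim X = n := by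
  rw [Scheme.topologicalKrullDim_eq_iSup_ringKrullDim_stalk]
  apply le_antisymm
  · exact iSup_le fun x => ringKrullDim_stalk_le_of_smoothOfRelativeDimension f n x
  · obtain ⟨x⟩ := ‹Nonempty X›
    obtain ⟨y, hy⟩ := exists_ringKrullDim_stalk_eq_of_smoothOfRelativeDimension f n x
    exact le_iSup_of_le y hy.ge

/-- `ℕ`-valued form: a non-empty scheme smooth of relative dimension `n` over a field has
`Literature.schemeDim X = n` (Görtz–Wedhorn I, Lemma 6.26 with Lemma 5.7 (4)).
[cite: GortzWedhorn2020, Lemma 6.26 and Lemma 5.7 (4)] -/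
theorem schemeDim_eq_of_smoothOfRelativeDimension [SmoothOfRelativeDimension n f] [Nonempty X] :
    schemeDim X = n := by
  unfold schemeDim
  rw [topologicalKrullDim_eq_of_smoothOfRelativeDimension f n]
  rfl

end Scheme

/-! ### Discharge of `Literature.AlgebraicGeometry.Motives.schemeDim_eq` -/

/-- **Discharge of the named fact `Literature.AlgebraicGeometry.Motives.schemeDim_eq`.** A smooth projective geometrically
irreducible variety `X` of relative dimension `n` over a field `k` has dimension `n`
(Hartshorne II Ex. 3.20 and III.10; Görtz–Wedhorn I, Lemma 6.26 with Lemma 5.7 (4)): `X` is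
non-empty, being geometrically irreducible over the one-point scheme `Spec k` (Mathlib
`GeometricallyIrreducible.irreducibleSpace_of_subsingleton`), and `X → Spec k` is smooth of
relative dimension `n`, so `topologicalKrullDim_eq_of_smoothOfRelativeDimension` applies;
projectivity is not needed.
[cite: GortzWedhorn2020, Lemma 6.26 and Lemma 5.7 (4)] [cite: Hartshorne1977, III.10 (definition of relative dimension preceding Prop. 10.1) and II Ex. 3.20] -/
theorem schemeDim_eq_holds {k : Type u} [Field k] {n : ℕ} {X : SchemeOver k} :
    schemeDim_eq (n := n) (X := X) := by
  intro h
  haveI := h.smoothOfRelativeDimension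
  haveI := h.geometricallyIrreducible
  haveI : IrreducibleSpace X.left :=
    AlgebraicGeometry.GeometricallyIrreducible.irreducibleSpace_of_subsingleton X.hom
  exact schemeDim_eq_of_smoothOfRelativeDimension X.hom n

end Literature.AlgebraicGeometry.Motives
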